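import Summits.MatrixMultiplication.OmegaCensus.STPPVosperPrimePairLaws

/-!
# ω-census (abelian STPP census): two-reading Vosper-table kills at order 59 (kernel)

HONEST FRAMING (pub-omega census; verbatim): lottery ticket; floor = certified bounds/negative ranges.
Census STRUCTURE (seat pub-omega-stpp-1 gen 29, 2026-08-28), family (b2).  Applications of the general-prime double and inverse-pair laws
(`STPPVosperPrimePairLaws.lean`) at `p = 59` to two leaves of the ℤ₅₉ residual front of record (HOME `pub-omega-stpp-1-g27/fronts/Z59-n9-stack-n18.json`;
both already ENGINE-dead through the `(3,3,3)`-cores of HOME `pub-omega-stpp-1-g28/`): `{(1,1,2),(1,2,1),(2,1,1),(3,3,3),(3,3,3)}` (double law at a `(3,3,3)`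
block, readings `(a,b,c)` + `(a,c,b)`) and `{(2,2,4),(3,3,2),(3,3,3)}` (inverse-pair law at the `(3,3,3)` block, readings `(a,b,c)` + `(b,a,c)`).  Both use the single
table `(43, 16, 3)` at order `59`, whose survivors are `{0, ±1, ±29}` (`30 ≡ −29`); `29², 29·30, 30² ≢ ±1 (mod 59)`.  With `STPPVosperTableKillsZ59P1/P2` this makes
`16` of the `31` ℤ₅₉ residual leaves KERNEL-dead (the 17th two-reading candidate `{(3,3,3),(3,3,4)}` needs four readings and is not treated).  Nothing here is
progress on `ω`.

References: A. G. Vosper, J. London Math. Soc. 31 (1956); M. B. Nathanson, *Additive Number Theory: Inverse Problems*, GTM 165, Thm 2.7; H. Cohn,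
R. Kleinberg, B. Szegedy, C. Umans, FOCS 2005 (arXiv:math/0511460), Def. 5.1.
-/

open Finset
open scoped Pointwise

namespace Summit.MatrixMultiplication.OmegaCensus.CubeNB

open Literature.Computability.AlgebraicComplexity
open Literature.Combinatorics.Additive
open Summit.MatrixMultiplication.OmegaCensus.STPPKneser

/-- Table `(43, 16, 3)` at order `59` with the exceptional ratio: survivors `{0, 1, 58, 29, 30}`. [folklore] -/
theorem table59_43_16_3_x : ∀ j < 59, ∀ t < 59, (∀ i < 16, (t + j * i) % 59 < 43) →
    (∀ k < 16, 3 ∣ (t + j * k) % 59 - #((range 16).filter fun i => (t + j * i) % 59 < (t + j * k) % 59)) →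
    j ∈ ({0, 1, 59 - 1, 29, 30} : Finset ℕ) := by
  decide +kernel

/-- The arithmetic of the exceptional ratio at `59`: `29 + 30 ≡ 0`, `29 ≢ 0`. [folklore] -/
theorem c29_c30 : ((29 : ℕ) : ZMod 59) + ((30 : ℕ) : ZMod 59) = 0 ∧ ((29 : ℕ) : ZMod 59) ≠ 0 := by
  constructor <;> decide

/-- The side condition at `59`: `d₁d₂ ≡ ±1 (mod 59)` with `d₁, d₂ ∈ {0, 1, 58, 29, 30}` forces `d₁ = ±1`. [folklore] -/
theorem side59_2930 : ∀ d₁ ∈ ({0, 1, 59 - 1, 29, 30} : Finset ℕ), ∀ d₂ ∈ ({0, 1, 59 - 1, 29, 30} : Finset ℕ),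
    (d₁ * d₂ % 59 = 1 ∨ d₁ * d₂ % 59 = 59 - 1) → (d₁ = 1 ∨ d₁ = 59 - 1) := by
  decide

/-- **`{(1,1,2),(1,2,1),(2,1,1),(3,3,3),(3,3,3)}` has no STPP family in `ℤ/59ℤ`** (double law at a `(3,3,3)` block: readings `(a,b,c)` and `(a,c,b)`,
`(z,b,vol,a,L) = (14,3,27,3,14)` twice, table `(43,16,3)` twice). [cite: CohnKleinbergSzegedyUmans2005, Def. 5.1] [cite: Nathanson1996, Thm 2.7] -/
theorem no_isSTPP_zmod59_112_121_211_333_333 (A B C : Fin 5 → Finset (ZMod 59)) (hS : IsSTPP A B C)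
    (hA : ∀ i, #(A i) = ![1, 1, 2, 3, 3] i) (hB : ∀ i, #(B i) = ![1, 2, 1, 3, 3] i) (hC : ∀ i, #(C i) = ![2, 1, 1, 3, 3] i) :
    False := by
  haveI : Fact (Nat.Prime 59) := ⟨by norm_num⟩
  have hAne : ∀ i, (A i).Nonempty := fun i => card_pos.1 (by rw [hA]; fin_cases i <;> simp)
  have hBne : ∀ i, (B i).Nonempty := fun i => card_pos.1 (by rw [hB]; fin_cases i <;> simp)
  have hCne : ∀ i, (C i).Nonempty := fun i => card_pos.1 (by rw [hC]; fin_cases i <;> simp)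
  have e3 : (univ : Finset (Fin 5)).erase 3 = {0, 1, 2, 4} := by decide
  have hz : ∑ k ∈ (univ : Finset (Fin 5)).erase 3, #(A k) * #(C k) = 14 := by
    rw [e3, Finset.sum_insert (by decide), Finset.sum_insert (by decide), Finset.sum_pair (by decide)]; simp [hA, hC]
  have hL : ∑ k ∈ (univ : Finset (Fin 5)).erase 3, #(B k) * #(C k) = 14 := by
    rw [e3, Finset.sum_insert (by decide), Finset.sum_insert (by decide), Finset.sum_pair (by decide)]; simp [hB, hC]
  have hz' : ∑ k ∈ (univ : Finset (Fin 5)).erase 3, #(A k) * #(B k) = 14 := by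
    rw [e3, Finset.sum_insert (by decide), Finset.sum_insert (by decide), Finset.sum_pair (by decide)]; simp [hA, hB]
  have hL' : ∑ k ∈ (univ : Finset (Fin 5)).erase 3, #(C k) * #(B k) = 14 := by
    rw [e3, Finset.sum_insert (by decide), Finset.sum_insert (by decide), Finset.sum_pair (by decide)]; simp [hB, hC]
  exact no_isSTPP_of_two_tight_tables_prime A B C hS hAne hBne hCne 3 ⟨0, by decide⟩ (by rw [hA]; simp) (by rw [hB]; simp)
    (by rw [hC]; simp) (show 3 * 3 * 3 = 27 from rfl) hz hL hz' hL' (by norm_num) (by norm_num) (by norm_num) (by norm_num) (by norm_num)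
    (by norm_num) (by norm_num) (by norm_num) (by norm_num) (m := 16) (n := 43) (m' := 16) (n' := 43) rfl rfl rfl rfl c29_c30.1 c29_c30.2
    table59_43_16_3_x table59_43_16_3_x

/-- **`{(2,2,4),(3,3,2),(3,3,3)}` has no STPP family in `ℤ/59ℤ`** (inverse-pair law at the `(3,3,3)` block: readings `(a,b,c)` and `(b,a,c)`,
`(z,b,vol,a,L) = (14,3,27,3,14)`, table `(43,16,3)` twice, side condition `side59_2930`). [cite: CohnKleinbergSzegedyUmans2005, Def. 5.1]
[cite: Nathanson1996, Thm 2.7] -/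
theorem no_isSTPP_zmod59_224_332_333 (A B C : Fin 3 → Finset (ZMod 59)) (hS : IsSTPP A B C)
    (hA : ∀ i, #(A i) = ![2, 3, 3] i) (hB : ∀ i, #(B i) = ![2, 3, 3] i) (hC : ∀ i, #(C i) = ![4, 2, 3] i) : False := by
  haveI : Fact (Nat.Prime 59) := ⟨by norm_num⟩
  have hAne : ∀ i, (A i).Nonempty := fun i => card_pos.1 (by rw [hA]; fin_cases i <;> simp)
  have hBne : ∀ i, (B i).Nonempty := fun i => card_pos.1 (by rw [hB]; fin_cases i <;> simp)
  have hCne : ∀ i, (C i).Nonempty := fun i => card_pos.1 (by rw [hC]; fin_cases i <;> simp)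
  have e2 : (univ : Finset (Fin 3)).erase 2 = {0, 1} := by decide
  have hz : ∑ k ∈ (univ : Finset (Fin 3)).erase 2, #(A k) * #(C k) = 14 := by
    rw [e2, Finset.sum_pair (by decide)]; simp [hA, hC]
  have hL : ∑ k ∈ (univ : Finset (Fin 3)).erase 2, #(B k) * #(C k) = 14 := by
    rw [e2, Finset.sum_pair (by decide)]; simp [hB, hC]
  exact no_isSTPP_of_inverse_pair_tables_prime A B C hS hAne hBne hCne 2 ⟨0, by decide⟩ (by rw [hA]; simp) (by rw [hB]; simp) (by rw [hC]; simp)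
    (show 3 * 3 * 3 = 27 from rfl) hz hL (by norm_num) (by norm_num) (by norm_num) (by norm_num) (by norm_num) (by norm_num)
    (m := 16) (n := 43) (m'' := 16) (n'' := 43) rfl rfl rfl rfl table59_43_16_3_x table59_43_16_3_x side59_2930

end Summit.MatrixMultiplication.OmegaCensus.CubeNB
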